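import Literature.AlgebraicGeometry.ShimuraVarieties.UnitaryBallProjectiveEmbedding
import Literature.AlgebraicGeometry.ShimuraVarieties.UnitaryBallPoincareSeparationOfLatticeSum
import Literature.AlgebraicGeometry.ShimuraVarieties.UnitaryBallPoincareFormsOfLatticeSum
import Literature.AlgebraicGeometry.ShimuraVarieties.CompactBallQuotientProjectiveEmbedding
import Literature.Geometry.ComplexHyperbolic.UnitBallLatticeSumVolume
import Literature.Geometry.ComplexHyperbolic.UnitBallDiscontinuousCornerFinite
import HarnessLib

/-!
# Compact ball quotients are projective: Shafarevich's theorem for `𝔹²`, the junction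

Discharge scheme of the record `compactBallQuotient_projectiveEmbedding`
(`CompactBallQuotientProjectiveEmbedding.lean`, Shafarevich IX §3.2 Theorem for `𝔹²`): the assembly
`BallProjective.exists_projective_embedding_of_hasFDerivAt` (`UnitaryBallProjectiveEmbedding.lean`) fed with
the pointwise lemmas of Shafarevich IX §3.2 PROVED in the tree in lattice-sum form —
`BallPoincare.exists_poincareSeries_separates_of_latticeSum_subgroup` (Lemma (A), points;
`UnitaryBallPoincareSeparationOfLatticeSum.lean`), `BallPoincare.exists_poincareSeries_immersion_subgroup`
(Lemma (B), tangent vectors; `UnitaryBallPoincareImmersion.lean`) — and with the membership of Poincaré series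
of weight `k ≥ 2` in `holFactorForms Δ (canonicalCocycle ℂ k)`
(`BallPoincare.poincareSeries_mem_holFactorForms_of_latticeSum_subgroup`,
`UnitaryBallPoincareFormsOfLatticeSum.lean`); the lattice sums `∑_γ ‖γ₂₂‖⁻ⁿ` (`n ≥ 6`) converge for every
properly discontinuous `Δ` (Shafarevich IX §3.1 Proposition:
`BallModel.summable_inv_norm_22_pow_of_cornerFinite_subgroup`, `UnitBallLatticeSumVolume.lean`, with the
corner finiteness `BallModel.finite_setOf_norm_22_subtype_le`, `UnitBallDiscontinuousCornerFinite.lean`).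

PROVED here (no hypotheses left): `BallProjective.exists_projective_embedding_of_latticeSum` (one `Δ`, from
its lattice sums), `BallProjective.exists_projective_embedding` (one `Δ`: free, properly discontinuous,
compact quotient ⇒ a holomorphic injective immersion `Δ\𝔹² → ℙᴺ(ℂ)`),
`compactBallQuotient_projectiveEmbedding_of_latticeSum` and **`compactBallQuotient_projectiveEmbedding_holds`**
— the DISCHARGE of the record `compactBallQuotient_projectiveEmbedding` (every hypothesis of the cell's h₁
chain below the algebraisation is now a theorem).

References: I. R. Shafarevich, *Basic Algebraic Geometry 2* (1994), Ch. IX §3.1 Proposition, §3.2 Theorem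
and Lemma (held chunks p0268–p0271).

## Provenance

pub-hodgecm2 cell (COR-CM, Hodge ladder stage 2), LIT-FANOUT row D4: junction of D4-6-asm (b06) with the
lattice-sum family D4-4-backstop / FormsOfLatticeSum (b28) and D4-5-up (b29); writer b06 per lead gen 4
(INBOX 2026-08-21T01:00:39Z). Theorems only; no definitions, no named facts.
-/

set_option autoImplicit false

noncomputable section

open scoped Manifold ContDiff Topology LinearAlgebra.Projectivization
open Set Filter MulAction
open Literature.Geometry.ComplexHyperbolic
open Literature.Geometry.ComplexHyperbolic.BallModel (U21 Ball nsq mat)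

namespace Literature.AlgebraicGeometry.ShimuraVarieties

namespace BallProjective

open BallForms (holFactorForms canonicalCocycle canonicalFactor extend holomorphic)

variable (Δ : Subgroup U21) [ProperlyDiscontinuousSMul Δ Ball] [IsCancelSMul Δ Ball]

/-- **Compact ball quotients embed projectively — modulo the lattice sums.** For `Δ ≤ U(2,1)` free,
properly discontinuous, with compact quotient and convergent lattice sums `∑_γ ‖γ₂₂‖⁻ⁿ` (`n ≥ 6`), the
quotient `Δ\𝔹²` admits a holomorphic injective immersion into some `ℙᴺ(ℂ)`: Shafarevich's Lemma (A)
(`exists_poincareSeries_separates_of_latticeSum_subgroup`) and Lemma (B)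
(`exists_poincareSeries_immersion_subgroup`), with the Poincaré series placed in
`holFactorForms Δ (canonicalCocycle ℂ k)` by `poincareSeries_mem_holFactorForms_of_latticeSum_subgroup`
(weight `k = max k₀ 2`), feed the assembly `exists_projective_embedding_of_hasFDerivAt`.
[cite: Shafarevich1994, Ch. IX §3.2, Theorem] -/
theorem exists_projective_embedding_of_latticeSum [CompactSpace (orbitRel.Quotient Δ Ball)]
    (hS : ∀ n : ℕ, 6 ≤ n → Summable fun γ : Δ ↦ (‖mat (γ : U21) 2 2‖ ^ n)⁻¹) :
    ∃ (N : ℕ) (F : orbitRel.Quotient Δ Ball → ℙ ℂ (Fin (N + 1) → ℂ)),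
      ContMDiff 𝓘(ℂ, Fin 2 → ℂ) 𝓘(ℂ, Fin N → ℂ) ω F ∧ Function.Injective F ∧
        ∀ x, Function.Injective (mfderiv 𝓘(ℂ, Fin 2 → ℂ) 𝓘(ℂ, Fin N → ℂ) F x) := by
  -- membership of the Poincaré series of weight `k ≥ 2` in `holFactorForms Δ (canonicalCocycle ℂ k)`
  have hmem : ∀ k : ℕ, 2 ≤ k → ∀ φ : Ball → ℂ, φ ∈ holomorphic ℂ → (∃ B : ℝ, ∀ z, ‖φ z‖ ≤ B) →
      (∃ B' : ℝ, ∀ z : Ball, ‖fderiv ℂ (extend ℂ φ) z.1‖ ≤ B') →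
        (fun z ↦ ∑' γ : Δ, canonicalFactor (γ : U21) z ^ k * φ ((γ : U21) • z)) ∈
          holFactorForms Δ (canonicalCocycle ℂ k) := by
    rintro k hk φ hφh ⟨B, hB⟩ ⟨B', hB'⟩
    exact BallPoincare.poincareSeries_mem_holFactorForms_of_latticeSum_subgroup Δ hS hk hφh hB hB'
  refine exists_projective_embedding_of_hasFDerivAt Δ (fun z w hzw ↦ ?_) (fun z ↦ ?_)
  · -- Lemma (A): separation of points
    obtain ⟨φ, hφh, hB, hB', k₀, hk₀⟩ :=
      BallPoincare.exists_poincareSeries_separates_of_latticeSum_subgroup Δ hS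
        (z := z) (w := w) (fun γ ↦ hzw γ)
    refine ⟨max k₀ 2, lt_of_lt_of_le two_pos (le_max_right _ _), _,
      hmem _ (le_max_right _ _) (φ 0) (hφh 0) (hB 0) (hB' 0), _,
      hmem _ (le_max_right _ _) (φ 1) (hφh 1) (hB 1) (hB' 1), ?_⟩
    exact sub_ne_zero.1 (hk₀ _ (le_max_left _ _))
  · -- Lemma (B): separation of tangent vectors
    obtain ⟨φ, hφh, hB, hB', k₀, hk₀⟩ := BallPoincare.exists_poincareSeries_immersion_subgroup Δ hS z
    obtain ⟨L, hL, -, hdet⟩ := hk₀ (max k₀ 2) (le_max_left _ _)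
    exact ⟨max k₀ 2, lt_of_lt_of_le two_pos (le_max_right _ _),
      fun i z ↦ ∑' γ : Δ, canonicalFactor (γ : U21) z ^ (max k₀ 2) * φ i ((γ : U21) • z),
      fun i ↦ hmem _ (le_max_right _ _) (φ i) (hφh i) (hB i) (hB' i), L, hL, hdet⟩

/-- **Compact free quotients of the 2-ball embed holomorphically into projective space** (Shafarevich IX §3.2
Theorem for `𝔹²`, no hypothesis left): for `Δ ≤ U(2,1)` acting freely and properly discontinuously on `𝔹²`
with compact quotient there are `N` and `F : Δ\𝔹² → ℙᴺ(ℂ)` holomorphic, injective, with injective differential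
everywhere. The lattice sums come from `BallModel.summable_inv_norm_22_pow_of_cornerFinite_subgroup` and the
corner finiteness `BallModel.finite_setOf_norm_22_subtype_le` of properly discontinuous subgroups.
[cite: Shafarevich1994, Ch. IX §3.2, Theorem] -/
theorem exists_projective_embedding [CompactSpace (orbitRel.Quotient Δ Ball)] :
    ∃ (N : ℕ) (F : orbitRel.Quotient Δ Ball → ℙ ℂ (Fin (N + 1) → ℂ)),
      ContMDiff 𝓘(ℂ, Fin 2 → ℂ) 𝓘(ℂ, Fin N → ℂ) ω F ∧ Function.Injective F ∧
        ∀ x, Function.Injective (mfderiv 𝓘(ℂ, Fin 2 → ℂ) 𝓘(ℂ, Fin N → ℂ) F x) :=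
  exists_projective_embedding_of_latticeSum Δ fun _ hn ↦
    BallModel.summable_inv_norm_22_pow_of_cornerFinite_subgroup Δ
      (BallModel.finite_setOf_norm_22_subtype_le Δ) hn

/-- The cocompact spelling: `Δ` cocompact in `U(2,1)` (`CompactSpace (U21 ⧸ Δ)`).
[cite: Shafarevich1994, Ch. IX §3.2, Theorem] -/
theorem exists_projective_embedding_of_cocompact [CompactSpace (U21 ⧸ Δ)] :
    ∃ (N : ℕ) (F : orbitRel.Quotient Δ Ball → ℙ ℂ (Fin (N + 1) → ℂ)),
      ContMDiff 𝓘(ℂ, Fin 2 → ℂ) 𝓘(ℂ, Fin N → ℂ) ω F ∧ Function.Injective F ∧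
        ∀ x, Function.Injective (mfderiv 𝓘(ℂ, Fin 2 → ℂ) 𝓘(ℂ, Fin N → ℂ) F x) := by
  haveI : CompactSpace (orbitRel.Quotient Δ Ball) :=
    BallModel.compactSpace_quotient_of_compactSpace_quotientGroup Δ
  exact exists_projective_embedding Δ

end BallProjective

/-- **The record `compactBallQuotient_projectiveEmbedding`, modulo the lattice sums** (convergence of
`∑_γ ‖γ₂₂‖⁻ⁿ`, `n ≥ 6`, for every properly discontinuous `Δ ≤ U(2,1)`: the tree theorem
`BallPoincare.summable_inv_norm_22_pow Δ.subtype (BallModel.finite_setOf_norm_22_subtype_le Δ)` of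
`UnitaryBallPoincareSeries.lean`, Shafarevich IX §3.1 Proposition). [cite: Shafarevich1994, Ch. IX §3.2, Theorem] -/
theorem compactBallQuotient_projectiveEmbedding_of_latticeSum
    (hS : ∀ (Δ : Subgroup U21) [ProperlyDiscontinuousSMul Δ Ball], ∀ n : ℕ, 6 ≤ n →
      Summable fun γ : Δ ↦ (‖mat (γ : U21) 2 2‖ ^ n)⁻¹) :
    compactBallQuotient_projectiveEmbedding := by
  intro Δ _ _ _
  exact BallProjective.exists_projective_embedding_of_latticeSum Δ (hS Δ)

/-- **Discharge of the record `compactBallQuotient_projectiveEmbedding`** (Shafarevich, *Basic Algebraic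
Geometry 2*, Ch. IX §3.2 Theorem with the closing Remark, for the ball `𝔹² ⊂ ℂ²`): every compact free properly
discontinuous quotient `Δ\𝔹²`, `Δ ≤ U(2,1)`, embeds holomorphically, injectively and immersively into some
`ℙᴺ(ℂ)` by finitely many Poincaré series of one weight. Assembled from: the convergence of Poincaré series /
lattice sums (§3.1 Proposition: `UnitBallLatticeSumVolume.lean`, `UnitaryBallPoincareImmersion.lean`), their
automorphy and holomorphy (`UnitaryBallPoincareFormsOfLatticeSum.lean`), Lemma (A) point separation
(`UnitaryBallPoincareSeparationOfLatticeSum.lean`), Lemma (B) tangent separation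
(`UnitaryBallPoincareImmersion.lean`), and the compactness / common-weight assembly
(`UnitaryBallProjectiveEmbedding.lean`). [cite: Shafarevich1994, Ch. IX §3.2, Theorem] -/
theorem compactBallQuotient_projectiveEmbedding_holds : compactBallQuotient_projectiveEmbedding := by
  intro Δ _ _ _
  exact BallProjective.exists_projective_embedding Δ

end Literature.AlgebraicGeometry.ShimuraVarieties

end
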